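import Summits.Ventures.HodgeRepro.CMHodgeGalois
import Summits.Ventures.HodgeRepro.Night1ProductWeilRational

/-!
# Weil's criterion on the kernel, all-or-nothing: the Weil space of a corner product either consists of
joint `(k, k)`-classes for every Galois conjugate (constant-sum family) or meets them only in `0`; at the
rational level ONE nonzero rational Weil class being such a class forces the constant-sum condition

Blind re-derivation cell `pub-hodge-repro`, seat `night-1` (gen 5).  Imports night-1's
`Night1ProductWeilRational` (the `ℚ`-structure `ratWeil φ₀ e f = Σ_g φ₀(g f) e_g`, the dual functionals
`lineDual`, the Weil space `weilSpaceProd G k e = span {e_σ}` of the full corner product `B = ∏_i A_{T i}`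
on the `G`-set `ι × G`, and typer-2's joint eigenspace `jointEigenspaceOn` of the conjugate cocharacters).

The printed sentence behind gens 3–4 (Milne 2020 §2.2, paper:arxiv-2010.08857 p0004:L24–29 = Deligne LNM 900
§5 (c)) is the «if» half: a constant-sum family («`Σ_i φ_i(s) = p` for all `s`») makes `W_E(A)` consist of
Hodge classes.  This file records the SHARP form of the criterion on the kernel, with no CM-type hypothesis
at all (the eigenvalue computation is pure combinatorics of the lines):

* `card_filter_mem_smul_eq` / `map_cocharOn_smul_weilWedgeProd` — the conjugate type `g • T` scales the
  `σ`-line by `λ^{m_{g⁻¹σ}}`, `m_τ = #{i : τ ∈ T i}`; hence `weilWedgeProd_mem_jointEigenspaceOn_of_sumP` and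
  `weilSpaceProd_le_jointEigenspaceOn_of_sumP` (p376653's theorem without `hc`, `hT`);
* `eq_sum_lineDual_smul` — every `ω` in the Weil space is `Σ_σ ⟨e^*_σ, ω⟩ e_σ` (`k ≥ 1`), and
  `lineDual_map_cocharOn` — the cocharacters act DIAGONALLY in the line basis;
* **`card_filter_eq_of_mem_jointEigenspaceOn`** — a joint `(k, k)`-class `ω` of the Weil space with a
  nonzero `σ`-coefficient forces `m_{g⁻¹σ} = k` for EVERY `g` (evaluate the eigen-equation of `μ_{g • T}` at
  `λ = 2` on the `σ`-coefficient: `2^{m_{g⁻¹σ}} a_σ = 2^k a_σ`); since `G` acts simply transitively on the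
  lines this is the constant-sum condition for all of `T`: **`sumP_of_lineDual_ne_zero`**;
* **`weilSpaceProd_inf_jointEigenspaceOn_eq_bot`** / **`weilSpaceProd_le_or_inf_eq_bot`** — ALL OR NOTHING:
  unless the family has constant sum, the Weil space contains NO nonzero joint `(k, k)`-class; so the Weil
  space is either entirely Hodge for every conjugate or trivially so (`exists_ne_zero_mem_iff_sumP`,
  `weilSpaceProd_le_jointEigenspaceOn_iff_sumP'`);
* at the rational level, for a Galois CM field `K` with base embedding `φ₀` (`G = Gal(K/ℚ)`): every
  coefficient `φ₀(g f)` of a nonzero rational Weil class is nonzero (`lineDual_ratWeil_ne_zero`,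
  `ratWeil_ne_zero`), so **`ratWeil_mem_jointEigenspaceOn_iff`** — `ratWeil f` (`f ≠ 0`) is a joint
  `(k, k)`-class for every conjugate IFF `SumP k T` — and `exists_ratWeil_mem_iff_forall`: one nonzero
  rational Weil class is Hodge for every conjugate iff all of them are.  Instance: the rational Weil classes
  of every rank-four face on its full four-corner product (`face_ratWeil_mem_jointEigenspaceOn`).

Reading (not a claim about varieties): with `H¹(B, ℚ) = K^ι` (the route's (β) bookkeeping, paper-level —
NIGHT1.md §12) the rational Weil classes `ratWeil f` are the elements of `W_K(B)`, and «joint `(k, k)`-class for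
every conjugate cocharacter» is typer-2's dictionary for «Hodge class»; the dichotomy says that `W_K(B)` is
a space of Hodge classes exactly when the corner family is balanced, and otherwise contains no Hodge class
at all.  Nothing geometric is built; every statement is about coordinate wedges on the finite `G`-set
`ι × G`.  Nothing here says anything about the status of the Hodge conjecture for CM abelian varieties,
which is NOT proved.
-/

set_option autoImplicit false

open Finset Module
open scoped Pointwise

namespace HodgeRepro.RouteC

open CMHodgeOn

section Model

variable {G : Type*} [Group G] [DecidableEq G] [Fintype G] {ι : Type*} [Fintype ι] [DecidableEq ι]

/-! ### The conjugate types: `σ ∈ g • T i ↔ g⁻¹ σ ∈ T i` -/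

omit [Fintype G] [DecidableEq ι] in
/-- The number of corners of the conjugate family `g • T` containing `σ` is the number of corners of `T`
containing `g⁻¹ σ`. -/
theorem card_filter_mem_smul_eq (T : ι → Finset G) (g σ : G) :
    (univ.filter fun i => σ ∈ g • T i).card = (univ.filter fun i => g⁻¹ * σ ∈ T i).card := by
  congr 1
  ext i
  simp only [mem_filter, mem_univ, true_and]
  rw [← Finset.inv_smul_mem_iff, smul_eq_mul]

/-- **The Hodge type of the `σ`-line for the conjugate type `g • T`**: `⋀^{2k} μ_{g • T}(λ)` scales it by
`λ^{m_{g⁻¹σ}}`, `m_τ = #{i : τ ∈ T i}`. -/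
theorem map_cocharOn_smul_weilWedgeProd {k : ℕ} (T : ι → Finset G) (e : Fin (2 * k) ≃ ι) (g σ : G)
    (lam : ℂ) :
    exteriorPower.map (2 * k) (cocharOn (prodTypeSet fun i => g • T i) lam) (weilWedgeProd e σ) =
      lam ^ (univ.filter fun i => g⁻¹ * σ ∈ T i).card • weilWedgeProd e σ := by
  rw [map_cocharOn_weilWedgeProd, card_filter_mem_smul_eq]

/-- **Every `σ`-line of a constant-sum family is a joint `(k, k)`-class for every conjugate**, with NO
CM-type hypothesis (p376653's `weilWedgeProd_mem_jointEigenspaceOn` without `hc`, `hT`): the eigenvalue of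
`μ_{g • T}` on the `σ`-line is `λ^{m_{g⁻¹σ}} = λ^k`. -/
theorem weilWedgeProd_mem_jointEigenspaceOn_of_sumP {k : ℕ} {T : ι → Finset G} (hsum : SumP k T)
    (e : Fin (2 * k) ≃ ι) (σ : G) :
    weilWedgeProd e σ ∈ jointEigenspaceOn (fun g : G => prodTypeSet fun i => g • T i) (2 * k) k := by
  rw [mem_jointEigenspaceOn_iff]
  intro g lam
  rw [map_cocharOn_smul_weilWedgeProd, hsum]

/-- The span form: the Weil space of a constant-sum family lies in the joint `(k, k)`-eigenspace of every
conjugate cocharacter (no CM-type hypothesis). -/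
theorem weilSpaceProd_le_jointEigenspaceOn_of_sumP {k : ℕ} {T : ι → Finset G} (hsum : SumP k T)
    (e : Fin (2 * k) ≃ ι) :
    weilSpaceProd G k e ≤ jointEigenspaceOn (fun g : G => prodTypeSet fun i => g • T i) (2 * k) k := by
  rw [weilSpaceProd, Submodule.span_le]
  rintro _ ⟨σ, rfl⟩
  exact weilWedgeProd_mem_jointEigenspaceOn_of_sumP hsum e σ

/-! ### Coefficients on the Weil space: the cocharacters are diagonal in the line basis -/

omit [Group G] [Fintype ι] in
/-- The coefficient of the `τ`-line in a combination of lines (`k ≥ 1`). -/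
theorem lineDual_sum_smul_weilWedgeProd {k : ℕ} (hk : 0 < k) (e : Fin (2 * k) ≃ ι) (a : G → ℂ)
    (τ : G) : lineDual e τ (∑ σ, a σ • weilWedgeProd e σ) = a τ := by
  rw [map_sum, Finset.sum_eq_single τ]
  · rw [map_smul, lineDual_weilWedgeProd_self, smul_eq_mul, mul_one]
  · intro σ _ hσ
    rw [map_smul, lineDual_weilWedgeProd_of_ne hk e (Ne.symm hσ), smul_zero]
  · intro h
    exact absurd (Finset.mem_univ τ) h

omit [Group G] [Fintype ι] in
/-- **Every element of the Weil space is the combination of the lines with its own coefficients**: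
`ω = Σ_σ ⟨e^*_σ, ω⟩ e_σ` (`k ≥ 1`). -/
theorem eq_sum_lineDual_smul {k : ℕ} (hk : 0 < k) (e : Fin (2 * k) ≃ ι)
    {ω : ⋀[ℂ]^(2 * k) ((ι × G) → ℂ)} (hω : ω ∈ weilSpaceProd G k e) :
    ω = ∑ σ, lineDual e σ ω • weilWedgeProd e σ := by
  rw [weilSpaceProd] at hω
  obtain ⟨a, rfl⟩ := (Submodule.mem_span_range_iff_exists_fun ℂ).1 hω
  refine Finset.sum_congr rfl fun σ _ => ?_
  rw [lineDual_sum_smul_weilWedgeProd hk e a σ]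

omit [Group G] [Fintype ι] in
/-- A nonzero element of the Weil space has a nonzero coefficient on some line (`k ≥ 1`). -/
theorem exists_lineDual_ne_zero {k : ℕ} (hk : 0 < k) (e : Fin (2 * k) ≃ ι)
    {ω : ⋀[ℂ]^(2 * k) ((ι × G) → ℂ)} (hω : ω ∈ weilSpaceProd G k e) (h0 : ω ≠ 0) :
    ∃ σ : G, lineDual e σ ω ≠ 0 := by
  by_contra h
  push Not at h
  apply h0
  rw [eq_sum_lineDual_smul hk e hω]
  exact Finset.sum_eq_zero fun σ _ => by rw [h σ, zero_smul]

omit [Group G] [Fintype G] [Fintype ι] in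
/-- `⋀^{2k} μ_Φ(λ)` scales the `σ`-line by `λ^{|line σ ∩ Φ|}` for ANY `Φ ⊆ ι × G`. -/
theorem map_cocharOn_weilWedgeProd' {k : ℕ} (Φ : Finset (ι × G)) (lam : ℂ) (e : Fin (2 * k) ≃ ι)
    (σ : G) :
    exteriorPower.map (2 * k) (cocharOn Φ lam) (weilWedgeProd e σ) =
      lam ^ cornerCountOn Φ (lineEnum e σ) • weilWedgeProd e σ := by
  unfold weilWedgeProd
  exact map_cocharOn_coordWedgeOn Φ lam (lineEnum e σ)

omit [Group G] [Fintype ι] in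
/-- `⋀^{2k} μ_Φ(λ)` on a combination of lines: each coefficient is multiplied by the line's eigenvalue. -/
theorem map_cocharOn_sum_smul_weilWedgeProd {k : ℕ} (Φ : Finset (ι × G)) (lam : ℂ)
    (e : Fin (2 * k) ≃ ι) (a : G → ℂ) :
    exteriorPower.map (2 * k) (cocharOn Φ lam) (∑ σ, a σ • weilWedgeProd e σ) =
      ∑ σ, (a σ * lam ^ cornerCountOn Φ (lineEnum e σ)) • weilWedgeProd e σ := by
  simp only [map_sum, map_smul, map_cocharOn_weilWedgeProd', smul_smul]

omit [Group G] [Fintype ι] in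
/-- **The cocharacters are diagonal in the line basis**: for `ω` in the Weil space, the `σ`-coefficient of
`⋀^{2k} μ_Φ(λ) ω` is `λ^{|line σ ∩ Φ|}` times the `σ`-coefficient of `ω` (`k ≥ 1`). -/
theorem lineDual_map_cocharOn {k : ℕ} (hk : 0 < k) (e : Fin (2 * k) ≃ ι) (Φ : Finset (ι × G))
    (lam : ℂ) {ω : ⋀[ℂ]^(2 * k) ((ι × G) → ℂ)} (hω : ω ∈ weilSpaceProd G k e) (σ : G) :
    lineDual e σ (exteriorPower.map (2 * k) (cocharOn Φ lam) ω) =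
      lam ^ cornerCountOn Φ (lineEnum e σ) * lineDual e σ ω := by
  conv_lhs => rw [eq_sum_lineDual_smul hk e hω, map_cocharOn_sum_smul_weilWedgeProd,
    lineDual_sum_smul_weilWedgeProd hk e _ σ]
  ring

/-! ### A nonzero coefficient forces the Hodge type of its line, hence of all lines -/

/-- **A nonzero coefficient forces the Hodge type of its line**: if `ω` in the Weil space is a joint
`(k, k)`-class for every conjugate and its `σ`-coefficient is nonzero, then `g⁻¹ σ` lies in exactly `k`
corners for EVERY `g` (`k ≥ 1`; evaluate the eigen-equation of `μ_{g • T}` at `λ = 2`). -/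
theorem card_filter_eq_of_mem_jointEigenspaceOn {k : ℕ} (hk : 0 < k) (e : Fin (2 * k) ≃ ι)
    (T : ι → Finset G) {ω : ⋀[ℂ]^(2 * k) ((ι × G) → ℂ)} (hω : ω ∈ weilSpaceProd G k e)
    (hJ : ω ∈ jointEigenspaceOn (fun g : G => prodTypeSet fun i => g • T i) (2 * k) k) {σ : G}
    (hσ : lineDual e σ ω ≠ 0) (g : G) : (univ.filter fun i => g⁻¹ * σ ∈ T i).card = k := by
  rw [mem_jointEigenspaceOn_iff] at hJ
  have h := congrArg (lineDual e σ) (hJ g 2)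
  rw [lineDual_map_cocharOn hk e _ 2 hω σ, map_smul, smul_eq_mul, cornerCountOn_prodTypeSet_lineEnum,
    card_filter_mem_smul_eq] at h
  have h2 : (2 : ℂ) ^ (univ.filter fun i => g⁻¹ * σ ∈ T i).card = 2 ^ k := mul_right_cancel₀ hσ h
  have h3 : ((2 ^ (univ.filter fun i => g⁻¹ * σ ∈ T i).card : ℕ) : ℂ) = ((2 ^ k : ℕ) : ℂ) := by
    push_cast
    exact h2
  exact Nat.pow_right_injective (le_refl 2) (Nat.cast_injective h3)

/-- **One nonzero coefficient forces the constant-sum condition** (`k ≥ 1`): `G` acts simply transitively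
on the lines, so the Hodge type of ONE line for ALL conjugates is the Hodge type of ALL lines. -/
theorem sumP_of_lineDual_ne_zero {k : ℕ} (hk : 0 < k) (e : Fin (2 * k) ≃ ι) (T : ι → Finset G)
    {ω : ⋀[ℂ]^(2 * k) ((ι × G) → ℂ)} (hω : ω ∈ weilSpaceProd G k e)
    (hJ : ω ∈ jointEigenspaceOn (fun g : G => prodTypeSet fun i => g • T i) (2 * k) k) {σ : G}
    (hσ : lineDual e σ ω ≠ 0) : SumP k T := by
  intro x
  have h := card_filter_eq_of_mem_jointEigenspaceOn hk e T hω hJ hσ (σ * x⁻¹)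
  rwa [mul_inv_rev, inv_inv, inv_mul_cancel_right] at h

/-- **Weil's criterion, sharp form** (`k ≥ 1`): a NONZERO element of the Weil space is a joint
`(k, k)`-class for every conjugate only if the family has constant sum. -/
theorem sumP_of_ne_zero_of_mem_jointEigenspaceOn {k : ℕ} (hk : 0 < k) (e : Fin (2 * k) ≃ ι)
    (T : ι → Finset G) {ω : ⋀[ℂ]^(2 * k) ((ι × G) → ℂ)} (hω : ω ∈ weilSpaceProd G k e) (h0 : ω ≠ 0)
    (hJ : ω ∈ jointEigenspaceOn (fun g : G => prodTypeSet fun i => g • T i) (2 * k) k) : SumP k T := by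
  obtain ⟨σ, hσ⟩ := exists_lineDual_ne_zero hk e hω h0
  exact sumP_of_lineDual_ne_zero hk e T hω hJ hσ

/-! ### All or nothing -/

/-- **Not constant-sum ⟹ no nonzero Hodge class in the Weil space** (`k ≥ 1`): the Weil space meets the
joint `(k, k)`-eigenspace of the conjugate cocharacters only in `0`. -/
theorem weilSpaceProd_inf_jointEigenspaceOn_eq_bot {k : ℕ} (hk : 0 < k) (e : Fin (2 * k) ≃ ι)
    (T : ι → Finset G) (h : ¬ SumP k T) :
    weilSpaceProd G k e ⊓ jointEigenspaceOn (fun g : G => prodTypeSet fun i => g • T i) (2 * k) k =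
      ⊥ := by
  rw [Submodule.eq_bot_iff]
  rintro ω ⟨hω, hJ⟩
  by_contra h0
  exact h (sumP_of_ne_zero_of_mem_jointEigenspaceOn hk e T hω h0 hJ)

/-- **The dichotomy** (`k ≥ 1`): the Weil space of a corner family is either contained in the joint
`(k, k)`-eigenspace of every conjugate cocharacter (constant sum) or meets it trivially. -/
theorem weilSpaceProd_le_or_inf_eq_bot {k : ℕ} (hk : 0 < k) (e : Fin (2 * k) ≃ ι)
    (T : ι → Finset G) :
    weilSpaceProd G k e ≤ jointEigenspaceOn (fun g : G => prodTypeSet fun i => g • T i) (2 * k) k ∨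
      weilSpaceProd G k e ⊓
        jointEigenspaceOn (fun g : G => prodTypeSet fun i => g • T i) (2 * k) k = ⊥ := by
  by_cases h : SumP k T
  · exact Or.inl (weilSpaceProd_le_jointEigenspaceOn_of_sumP h e)
  · exact Or.inr (weilSpaceProd_inf_jointEigenspaceOn_eq_bot hk e T h)

/-- Deligne's criterion with no CM-type hypothesis (`k ≥ 1`; p377610's
`weilSpaceProd_le_jointEigenspaceOn_iff_sumP` without `hc`, `hT`): the Weil space lies in the joint
`(k, k)`-eigenspace of every conjugate IFF the family has constant sum. -/
theorem weilSpaceProd_le_jointEigenspaceOn_iff_sumP' {k : ℕ} (hk : 0 < k) (e : Fin (2 * k) ≃ ι)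
    (T : ι → Finset G) :
    weilSpaceProd G k e ≤ jointEigenspaceOn (fun g : G => prodTypeSet fun i => g • T i) (2 * k) k ↔
      SumP k T := by
  refine ⟨fun h => ?_, fun h => weilSpaceProd_le_jointEigenspaceOn_of_sumP h e⟩
  refine sumP_of_lineDual_ne_zero hk e T (weilWedgeProd_mem_weilSpaceProd k e 1)
    (h (weilWedgeProd_mem_weilSpaceProd k e 1)) (σ := 1) ?_
  rw [lineDual_weilWedgeProd_self]
  exact one_ne_zero

/-- **Some nonzero Hodge class in the Weil space ⟺ the whole Weil space is Hodge ⟺ constant sum** (`k ≥ 1`). -/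
theorem exists_ne_zero_mem_iff_sumP {k : ℕ} (hk : 0 < k) (e : Fin (2 * k) ≃ ι) (T : ι → Finset G) :
    (∃ ω ∈ weilSpaceProd G k e, ω ≠ 0 ∧
        ω ∈ jointEigenspaceOn (fun g : G => prodTypeSet fun i => g • T i) (2 * k) k) ↔
      SumP k T := by
  constructor
  · rintro ⟨ω, hω, h0, hJ⟩
    exact sumP_of_ne_zero_of_mem_jointEigenspaceOn hk e T hω h0 hJ
  · intro h
    exact ⟨weilWedgeProd e 1, weilWedgeProd_mem_weilSpaceProd k e 1, weilWedgeProd_ne_zero e 1,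
      weilWedgeProd_mem_jointEigenspaceOn_of_sumP h e 1⟩

end Model

/-! ### The rational level: a Galois CM field `K`, `G = Gal(K/ℚ)` -/

section Rational

open CMHodge
open scoped Classical

variable (K : Type*) [Field K] [NumberField K] [IsGalois ℚ K] (φ₀ : K →+* ℂ)
variable {ι : Type*} [Fintype ι] [DecidableEq ι]

omit [IsGalois ℚ K] [Fintype ι] in
/-- Every coefficient `φ₀(g f)` of a nonzero rational Weil class is nonzero (`k ≥ 1`). -/
theorem lineDual_ratWeil_ne_zero {k : ℕ} (hk : 0 < k) (e : Fin (2 * k) ≃ ι) {f : K} (hf : f ≠ 0)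
    (g : K ≃ₐ[ℚ] K) : lineDual e g (ratWeil K φ₀ e f) ≠ 0 := by
  rw [lineDual_ratWeil K φ₀ hk]
  exact (map_ne_zero φ₀).2 ((map_ne_zero g).2 hf)

omit [IsGalois ℚ K] [Fintype ι] in
/-- `ratWeil f ≠ 0` for `f ≠ 0` (`k ≥ 1`). -/
theorem ratWeil_ne_zero {k : ℕ} (hk : 0 < k) (e : Fin (2 * k) ≃ ι) {f : K} (hf : f ≠ 0) :
    ratWeil K φ₀ e f ≠ 0 := by
  intro h
  apply lineDual_ratWeil_ne_zero K φ₀ hk e hf 1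
  rw [h, map_zero]

/-- **Weil's criterion at the rational level** (`k ≥ 1`, `f ≠ 0`): the rational Weil class `ratWeil f` is
a joint `(k, k)`-class of every conjugate cocharacter IFF the corner family has constant sum.  One nonzero
rational class decides it, because all its line coefficients `φ₀(g f)` are nonzero. -/
theorem ratWeil_mem_jointEigenspaceOn_iff {k : ℕ} (hk : 0 < k) (e : Fin (2 * k) ≃ ι)
    (T : ι → Finset (K ≃ₐ[ℚ] K)) {f : K} (hf : f ≠ 0) :
    ratWeil K φ₀ e f ∈
        jointEigenspaceOn (fun g : K ≃ₐ[ℚ] K => prodTypeSet fun i => g • T i) (2 * k) k ↔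
      SumP k T := by
  constructor
  · intro hJ
    exact sumP_of_lineDual_ne_zero hk e T (ratWeil_mem_weilSpaceProd K φ₀ e f) hJ
      (lineDual_ratWeil_ne_zero K φ₀ hk e hf 1)
  · intro h
    exact weilSpaceProd_le_jointEigenspaceOn_of_sumP h e (ratWeil_mem_weilSpaceProd K φ₀ e f)

/-- **One nonzero rational Weil class is Hodge for every conjugate iff all of them are** (`k ≥ 1`). -/
theorem exists_ratWeil_mem_iff_forall {k : ℕ} (hk : 0 < k) (e : Fin (2 * k) ≃ ι)
    (T : ι → Finset (K ≃ₐ[ℚ] K)) :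
    (∃ f : K, f ≠ 0 ∧ ratWeil K φ₀ e f ∈
        jointEigenspaceOn (fun g : K ≃ₐ[ℚ] K => prodTypeSet fun i => g • T i) (2 * k) k) ↔
      ∀ f : K, ratWeil K φ₀ e f ∈
        jointEigenspaceOn (fun g : K ≃ₐ[ℚ] K => prodTypeSet fun i => g • T i) (2 * k) k := by
  constructor
  · rintro ⟨f, hf, hJ⟩ f'
    exact weilSpaceProd_le_jointEigenspaceOn_of_sumP
      ((ratWeil_mem_jointEigenspaceOn_iff K φ₀ hk e T hf).1 hJ) e (ratWeil_mem_weilSpaceProd K φ₀ e f')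
  · intro h
    exact ⟨1, one_ne_zero, h 1⟩

/-- The all-or-nothing form at the rational level (`k ≥ 1`): if the family does not have constant sum, NO
nonzero rational Weil class is a joint `(k, k)`-class for every conjugate. -/
theorem ratWeil_not_mem_jointEigenspaceOn {k : ℕ} (hk : 0 < k) (e : Fin (2 * k) ≃ ι)
    (T : ι → Finset (K ≃ₐ[ℚ] K)) (h : ¬ SumP k T) {f : K} (hf : f ≠ 0) :
    ratWeil K φ₀ e f ∉
      jointEigenspaceOn (fun g : K ≃ₐ[ℚ] K => prodTypeSet fun i => g • T i) (2 * k) k :=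
  fun hJ => h ((ratWeil_mem_jointEigenspaceOn_iff K φ₀ hk e T hf).1 hJ)

/-- **Instance — the rank-four faces**: every rational Weil class of a face on its full four-corner product
(`Fin 4 × Gal(K/ℚ)`) is a joint `(2, 2)`-class of every conjugate cocharacter. -/
theorem face_ratWeil_mem_jointEigenspaceOn {c : K ≃ₐ[ℚ] K} (hc : IsComplexConj c)
    {Φ : Finset (K ≃ₐ[ℚ] K)} (hΦ : IsCMType c Φ) {π π' : K ≃ₐ[ℚ] K} (hπ : π' ∉ place c π) (f : K) :
    ratWeil K φ₀ (Equiv.refl (Fin (2 * 2))) f ∈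
      jointEigenspaceOn (fun g : K ≃ₐ[ℚ] K => prodTypeSet fun i => g • faceCorners c Φ π π' i)
        (2 * 2) 2 :=
  weilSpaceProd_le_jointEigenspaceOn_of_sumP (sumP_two_of_sumTwo (sumTwo_faceCorners hc hΦ hπ)) _
    (ratWeil_mem_weilSpaceProd K φ₀ _ f)

end Rational

end HodgeRepro.RouteC
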